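import Mathlib
import HarnessLib
import Summits.ValiantsHypothesis.ValiantsHypothesis.Theses.MonotoneRestoration
import Literature.Computability.AlgebraicComplexity.ArithCircuit
import Literature.Computability.AlgebraicComplexity.ArithCircuitProofs
import Literature.Computability.AlgebraicComplexity.MonotoneStructure
import Literature.Computability.AlgebraicComplexity.PermanentIrreducible
import Literature.ModelTheory.FiniteModelTheory.CkEquiv
import Summits.ValiantsHypothesis.ValiantsHypothesis.Theorems.MonotoneRestorationMonotoneRestorationQPCosetCount
import Summits.ValiantsHypothesis.ValiantsHypothesis.Theorems.MonotoneRestorationMonotoneRestorationQPSymmetricLB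
import Summits.ValiantsHypothesis.ValiantsHypothesis.Theorems.MonotoneRestorationMonotoneRestorationQPSupportSymmetrisation
import Summits.ValiantsHypothesis.ValiantsHypothesis.Theorems.MonotoneRestorationMonotoneRestorationQPSparseRegime
import Summits.ValiantsHypothesis.ValiantsHypothesis.Theorems.MonotoneRestorationMonotoneRestorationQPBeta
import Literature.Computability.AlgebraicComplexity.SymmetricArithCircuit
import Literature.Computability.AlgebraicComplexity.DawarWilsenach2025Proofs
import Literature.GroupTheory.PermutationGroups.SmallIndexSubgroups
import Summits.ValiantsHypothesis.ValiantsHypothesis.Theorems.MonotoneRestorationQP.Negative.LoadBearing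
import Summits.ValiantsHypothesis.ValiantsHypothesis.Theorems.MonotoneRestorationMonotoneRestorationQPPermSupportCount

/-! TTRL-lite variant V19903 of stmt-ValiantsHypothesis-15886 -/

-- `ValiantsHypothesis.ValiantsHypothesis`: the D-0017 layout repeats the problem name in the path.
set_option linter.dupNamespace false

namespace Summit.ValiantsHypothesis.ValiantsHypothesis.Theorems

open Summit.ValiantsHypothesis.ValiantsHypothesis.Theses.MonotoneRestoration
open Literature.Computability.AlgebraicComplexity

/-- **TTRL-lite variant V19903 of `stub_mulGate_children_extend`** (stmt-ValiantsHypothesis-15886;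
the first `have` of conjunct (2) of the parent stub, stated as pure circuit API over an arbitrary
commutative semiring): a `×`-gate `P` of a labelled arithmetic circuit factors through any two
*distinct* children `h ≠ h'` at once —
`eval P = eval h * eval h' * ∏_{x ∈ (children P \ {h}) \ {h'}} eval x`.
Proof: `eval P = ∏_{children P} eval` (`LabelledArithCircuit.eval_of_label_mul`), then
`Finset.mul_prod_erase` twice (`h ∈ children P`, and `h' ∈ (children P).erase h` since `h' ≠ h`),
and reassociate. [folklore] -/
theorem stub_mulGate_children_extend_var19903 :
    ∀ (K X Y G : Type) [CommSemiring K] [DecidableEq G] (C : LabelledArithCircuit K X Y G)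
      (P h h' : G), C.label P = .mul → h ∈ C.children P → h' ∈ C.children P → h ≠ h' →
      C.eval P = C.eval h * C.eval h' * ∏ x ∈ ((C.children P).erase h).erase h', C.eval x := by
  intro _ _ _ _ _ _ C P h h' hP hh hh' hne
  have hh'e : h' ∈ (C.children P).erase h := Finset.mem_erase.2 ⟨fun e => hne e.symm, hh'⟩
  rw [C.eval_of_label_mul hP, ← Finset.mul_prod_erase (C.children P) C.eval hh,
    ← Finset.mul_prod_erase ((C.children P).erase h) C.eval hh'e, mul_assoc]

end Summit.ValiantsHypothesis.ValiantsHypothesis.Theorems
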